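import Mathlib.Algebra.Group.Basic
import Mathlib.Algebra.Module.Defs
import Mathlib.Data.ZMod.Basic
import Mathlib.Data.Fintype.Prod
import Mathlib.Tactic.Abel
import Mathlib.Tactic.NormNum
import Mathlib.Tactic.DeriveFintype
import HarnessLib

/-!
# Prym–Torelli over an elliptic base at `f ≥ 15` — kernel skeleton (WEIL-2 gen 47, ELLBASE-G47, fact-free)

research route, not a corollary; conditional on HC_CM plus one named minimal statement.

Cell `pub-hodge-ring2-ab-*` (ALL ABELIAN VARIETIES), seat WEIL-2 gen 47, account
`run/shared/lean/pub/pub-hodge-ring2/pub-hodge-ring2-ab-weil-2/ELLBASE-G47.md`.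

Informal setting.  The last positive-dimensional non-split Galois–Prym data without a Prym–Torelli certificate were the
data at `f ≥ 15` over an ELLIPTIC base `E` (`G = ℤ/f ⋊ H`, `H ⊂ (ℤ/f)^×`): at `f = 15, 30` the group `H` is cyclic of order
`4` (`{1,2,4,8}` resp. `{1,17,19,23}`), at `f = 24` it is `{1,5,7,11}`.  ELLBASE-G47 proves: (i) the one-point data `[x^5]`,
`[x^{10}]` are empty (E-g42-1); (ii) every member of the other five families is Galois over `ℙ¹` (group `D₄` resp. `C₂³`), so
gen 46's bidouble engine applies; (iii) LEMMA A: the admissible classes form a torsor under `Γ = J[f]^{α = h}` with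
`Γ₃ = 0` (because `α² = τ` acts as `−1` on the odd part and `h ≢ ±…`: the abstract statement is `eq_zero_of_sq_eq_neg`
below), `|Γ₅| = 25`, `|Γ₂| = 4`; (iv) THEOREM K_E: generic immersion on every component (engine: all `24 / 72 / 72 / 32`
admissible classes of a member have full rank).

This file holds the finite bookkeeping: the crossed homomorphisms `H¹(C₄; ℤ/15) = 0`, `|H¹(C₄; ℤ/30)| = 2` behind the
dictionary «admissible classes ↔ G-covers», the residue orbits, the eigenvalue arithmetic `h² ≡ −1 (mod 5)`, the abstract
`3`-torsion lemma, the monomials of the `D₄` normal form, the Riemann–Hurwitz count, and the class/cover counts.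

0 sorry, no `def`, no named fact; `HC_CM` does not occur.
-/

namespace Summit.HodgeConjecture.Ring2AbelianAll.PrymTorelliEllipticBase

section torsion

variable {A : Type*} [AddCommGroup A]

/-- ELLBASE-G47 LEMMA A_II, the `3`-part: if an additive endomorphism `α` satisfies `α² = −1` (as `α² = τ` does on the
`E_S × E_U`-part of the Jacobian of the `(2,2,2)` bidouble curve) then `α` has no eigenvector with eigenvalue `−1` among the
`3`-torsion: `α t = −t` and `3 • t = 0` force `t = 0`.  Hence `Γ₃ = J[3]^{α = h} = 0` for `h ≡ −1 (mod 3)`.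
research route, not a corollary; conditional on HC_CM plus one named minimal statement. -/
theorem eq_zero_of_sq_eq_neg (α : A →+ A) (hα : ∀ t, α (α t) = -t) {t : A} (ht : α t = -t)
    (h3 : (3 : ℕ) • t = 0) : t = 0 := by
  have h1 : α (α t) = t := by rw [ht, map_neg, ht, neg_neg]
  have h2 : t = -t := by rw [← hα t, h1]
  have h22 : (2 : ℕ) • t = 0 := by
    rw [two_nsmul]
    nth_rewrite 2 [h2]
    exact add_neg_cancel t
  have h32 : t = (3 : ℕ) • t - (2 : ℕ) • t := by abel
  rw [h32, h3, h22, sub_zero]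

/-- ELLBASE-G47 LEMMA A_II, the `5`-part: on a group where `α² = −1`, an element with `α t = h • t` and `5 • t = 0`
satisfies `(h * h + 1) • t = 0`; so eigenvectors of eigenvalue `h` inside the `5`-torsion can only exist when
`h² ≡ −1 (mod 5)` — which holds for `h = 2, 8` (`f = 15`) and `h = 17, 23` (`f = 30`), see `sq_eq_neg_one_mod_five`.
research route, not a corollary; conditional on HC_CM plus one named minimal statement. -/
theorem sq_add_one_smul_eq_zero (α : A →+ A) (hα : ∀ t, α (α t) = -t) (h : ℕ) {t : A} (ht : α t = h • t) :
    (h * h + 1) • t = 0 := by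
  have h1 : α (α t) = (h * h) • t := by rw [ht, map_nsmul, ht, ← mul_nsmul]
  rw [add_nsmul, one_nsmul, ← h1, hα, neg_add_cancel]

end torsion

section arithmetic

/-- `h² ≡ −1 (mod 5)` for the generators `h` of `H` at `f = 15` (`2, 8`) and `f = 30` (`17, 23`); and `h ≡ −1 (mod 3)`
for all four (so `Γ₃ = 0` by `eq_zero_of_sq_eq_neg`).  [ELLBASE-G47 §2.2]
research route, not a corollary; conditional on HC_CM plus one named minimal statement. -/
theorem sq_eq_neg_one_mod_five :
    ((2 : ZMod 5) ^ 2 = -1 ∧ (8 : ZMod 5) ^ 2 = -1 ∧ (17 : ZMod 5) ^ 2 = -1 ∧ (23 : ZMod 5) ^ 2 = -1) ∧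
    ((2 : ZMod 3) = -1 ∧ (8 : ZMod 3) = -1 ∧ (17 : ZMod 3) = -1 ∧ (23 : ZMod 3) = -1) := by decide

/-- The groups `H`: `2` has order `4` in `(ℤ/15)^×` with `⟨2⟩ = {1,2,4,8}`, `17` has order `4` in `(ℤ/30)^×` with
`⟨17⟩ = {1,17,19,23}` (`19 = 17²` is the involution), and the residue orbits of the `N`-type branch classes:
`5·{1,2,4,8} = {5,10}` in `ℤ/15`, `10·{1,17,19,23} = {10,20}` in `ℤ/30`, `8·{1,5,7,11} = {8,16}` in `ℤ/24` — the residues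
alternate `(a, 2a, a, 2a)` around a `C₄`-orbit, so `δ = a·(Q₀ + 2Q₁ + Q₂ + 2Q₃)`.  [ELLBASE-G47 §0, §2.1]
research route, not a corollary; conditional on HC_CM plus one named minimal statement. -/
theorem residue_orbits :
    ((2 : ZMod 15) ^ 2 = 4 ∧ (2 : ZMod 15) ^ 3 = 8 ∧ (2 : ZMod 15) ^ 4 = 1) ∧
    ((17 : ZMod 30) ^ 2 = 19 ∧ (17 : ZMod 30) ^ 3 = 23 ∧ (17 : ZMod 30) ^ 4 = 1) ∧
    ((5 : ZMod 15) * 2 = 10 ∧ (10 : ZMod 15) * 2 = 5) ∧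
    ((10 : ZMod 30) * 17 = 20 ∧ (20 : ZMod 30) * 17 = 10) ∧
    ((8 : ZMod 24) * 5 = 16 ∧ (8 : ZMod 24) * 7 = 8 ∧ (8 : ZMod 24) * 11 = 16) := by decide

/-- The branch residues of the `H`-type classes: for `x^k s_h` the inertia of `C → C'` is `x^{k N_h}`, `N_h = 1 + h` for an
involution `h`.  At `f = 30`, `h = 19`: `N = 20`, so `x¹s₁₉ ↦ 20 ≠ 0` (branched) and `x³s₁₉ ↦ 60 = 0` (unbranched); at
`f = 24`, `h = 7`: `N = 8`: `x¹s₇ ↦ 8`, `x³s₇ ↦ 0`; at `f = 15`, `h = 4`: `N = 5`: `s₄ ↦ 0`, `x¹s₄ ↦ 5`.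
[ELLBASE-G47 §0]  research route, not a corollary; conditional on HC_CM plus one named minimal statement. -/
theorem branch_residues :
    ((1 + 19 : ZMod 30) = 20 ∧ (1 * 20 : ZMod 30) ≠ 0 ∧ (3 * 20 : ZMod 30) = 0) ∧
    ((1 + 7 : ZMod 24) = 8 ∧ (1 * 8 : ZMod 24) ≠ 0 ∧ (3 * 8 : ZMod 24) = 0) ∧
    ((1 + 4 : ZMod 15) = 5 ∧ (0 * 5 : ZMod 15) = 0 ∧ (1 * 5 : ZMod 15) ≠ 0) := by decide

/-- The dictionary «admissible classes ↔ `G`-covers» (ELLBASE-G47 §2.4): `N_cl = N_cov · c_δ / |H¹(H; N)|` with `c_δ = 2`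
(only `τ = α²` preserves the residue normalisation).  `H¹(C₄; ℤ/15)` with the generator acting by `2`: every `m` is a cocycle
value (`(1+2+4+8)m = 15m = 0`) and every `m` is a coboundary (`(2−1)m = m`): `|Z¹| = |B¹| = 15`, `H¹ = 0`.
research route, not a corollary; conditional on HC_CM plus one named minimal statement. -/
theorem crossedHom_C4_mod15 :
    (Finset.univ.filter (fun m : ZMod 15 => (1 + 2 + 4 + 8 : ZMod 15) * m = 0)).card = 15 ∧
    (Finset.univ.image (fun m : ZMod 15 => (2 - 1 : ZMod 15) * m)).card = 15 := by decide

/-- `H¹(C₄; ℤ/30)` with the generator acting by `17`: `|Z¹| = 30` (`1+17+19+23 = 60 = 0`), `|B¹| = |16·ℤ/30| = 15`, so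
`|H¹| = 2`.  [ELLBASE-G47 §2.4]  research route, not a corollary; conditional on HC_CM plus one named minimal statement. -/
theorem crossedHom_C4_mod30 :
    (Finset.univ.filter (fun m : ZMod 30 => (1 + 17 + 19 + 23 : ZMod 30) * m = 0)).card = 30 ∧
    (Finset.univ.image (fun m : ZMod 30 => (17 - 1 : ZMod 30) * m)).card = 15 := by decide

/-- `H¹(C₂×C₂; ℤ/24)` for `{1,5,7,11}` has order `2` (KLEIN-G46 `crossedHom_card`/`coboundary_card`: 24/12); here only
the consequence used in the dictionary at `f = 24` is restated as arithmetic together with the class/cover counts of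
ELLBASE-G47 §2.4: `f = 15`: `N_cl = 25 − 1 = 24 = 12 · 2 / 1`; `f = 30`: `(4 − 1)(25 − 1) = 72 = (24 + 48) · 2 / 2`;
`f = 24`: `64 / 2 = 32 = (16 + 16) · 2 / 2`.
research route, not a corollary; conditional on HC_CM plus one named minimal statement. -/
theorem class_cover_counts :
    (25 - 1 = 24 ∧ 12 * 2 / 1 = 24) ∧ ((4 - 1) * (25 - 1) = 72 ∧ (24 + 48) * 2 / 2 = 72) ∧
    (64 / 2 = 32 ∧ (16 + 16) * 2 / 2 = 32) ∧ (24 : ℕ) / 12 = 2 := by norm_num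

/-- Riemann–Hurwitz bookkeeping of LEMMA D (ELLBASE-G47 §1): a `C₄`-cover `C' → E` of an elliptic curve with two branch
points of index `2` has `2g' − 2 = 4·0 + 2·(4 − 4/2) = 4`, `g' = 3`; the `D₄`-quotient is rational:
`2·3 − 2 = 8·(2·0 − 2) + 20` with `20 = 0 + 4 + 0 + 4·4` the fixed points of `α, α², α³` and the four reflections; the
three Klein quotients `C'/j`, `C'/α²`, `C'/jα²` have genus `1` (`4 = 2·0 + 4`), so the bidouble split is `(2,2,2)`
(`g' = r − 3 = 3`, `r = 6`); for the `C₂³`-curve at `f = 24` the quotient genera `(1, 0, 2)` give the split `(2, 4, 0)`.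
research route, not a corollary; conditional on HC_CM plus one named minimal statement. -/
theorem riemann_hurwitz_bookkeeping :
    (2 * 3 - 2 = 4 * 0 + 2 * (4 - 4 / 2)) ∧ ((2 * 3 - 2 : ℤ) = 8 * (2 * 0 - 2) + 20 ∧ 20 = 0 + 4 + 0 + 4 * 4) ∧
    (2 * 3 - 2 = 2 * (2 * 1 - 2) + 4) ∧ (6 - 3 = 3) ∧
    ((2 + 2) / 2 - 1 = 1 ∧ (4 + 0) / 2 - 1 = 1 ∧ (2 + 0) / 2 - 1 = 0 ∧ (2 + 4) / 2 - 1 = 2) := by norm_num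

/-- LEMMA D, the `D₄` normal form: the quartic monomials `x^a y^b z^c` (`a + b + c = 4`) invariant under
`α = diag(1, i, −1)` are those with `b + 2c ≡ 0 (mod 4)`; they are exactly `x⁴, y⁴, z⁴, x²z², x y² z` — five of the
fifteen — and this set is invariant under `x ↔ z` (the extra involution `j`).  [ELLBASE-G47 §1.1]
research route, not a corollary; conditional on HC_CM plus one named minimal statement. -/
theorem d4_normal_form_monomials :
    (Finset.univ.filter (fun bc : Fin 5 × Fin 5 =>
        (bc.1 : ℕ) + bc.2 ≤ 4 ∧ ((bc.1 : ℕ) + 2 * bc.2) % 4 = 0)).card = 5 ∧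
    (∀ bc : Fin 5 × Fin 5, ((bc.1 : ℕ) + bc.2 ≤ 4 ∧ ((bc.1 : ℕ) + 2 * bc.2) % 4 = 0) →
        -- the monomial with exponents (a, b, c) = (4 - b - c, b, c) maps under x <-> z to (c, b, 4 - b - c): still invariant
        ((bc.1 : ℕ) + 2 * (4 - bc.1 - bc.2)) % 4 = 0) := by
  constructor
  · decide
  · decide

/-- The phantom data (E-g42-1, re-derived in ELLBASE-G47 §0 by tuple counts `0`): a one-point datum over an elliptic base
needs `[a, b] = g⁻¹` with `g` of order `3` in `N`; modulo `⟨g⟩` the images commute, but `G/⟨x^5⟩ ≅ ℤ/5 ⋊ C₄` (resp.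
`G/⟨x^{10}⟩ ⊇ ℤ/5 ⋊ C₄`) is non-abelian since `2 ≢ 1 (mod 5)` (resp. `17 ≢ 1 (mod 5)`), and it is generated by the two
images — contradiction.  Kernel content: the non-commutation `2·1 ≠ 1·1`-type facts.
research route, not a corollary; conditional on HC_CM plus one named minimal statement. -/
theorem phantom_noncommutative :
    ((2 : ZMod 5) ≠ 1 ∧ (17 : ZMod 5) = 2) ∧
    ((3 : ℕ) * 5 = 15 ∧ (5 : ZMod 15) ≠ 0 ∧ (2 : ℕ) * 5 % 15 = 10) ∧
    ((3 : ℕ) * 10 = 30 ∧ (10 : ZMod 30) ≠ 0 ∧ (17 : ℕ) * 10 % 30 = 20) := by decide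

end arithmetic

section everyMember

/-!
### P.S. (same gen): THEOREM G_E — the `s = 2` data over an elliptic base are immersive at EVERY member

Green's `H⁰`-lemma (a base-point-free `W ⊆ H⁰(L)` of dimension `w` and `h¹(M ⊗ L⁻¹) ≤ w − 2` give `W ⊗ H⁰(M) ↠ H⁰(L ⊗ M)`)
applied to `L = K' + D₀`, `M = K' + B' − D₀` (both of degree `2g'`, base-point free, `w = g' + 1`,
`h¹ = g' − 1 + h⁰(B' − 2D₀)`) makes the codifferential onto as soon as `2D₀ ≁ B'`; and for the `C₄`-data with `s = 2` LEMMA A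
gives `2D₀ − B' ∼ κ̃ + 2t` with `κ̃` of order exactly `2` and `f·t = 0`, `f ∈ {15, 30}`, which is never `0`.  The two abstract
group-theoretic facts and the Riemann–Roch bookkeeping are recorded below.  [ELLBASE-G47 §7]
-/

variable {A : Type*} [AddCommGroup A]

/-- ELLBASE-G47 THEOREM G_E, the torsion step at `f = 15`: in an additive commutative group, if `2 • κ = 0`, `15 • t = 0` and
`κ + 2 • t = 0` then `κ = 0` (and `t = 0`).  Hence `2D₀ − B' ∼ κ̃ + 2t` is never principal when `κ̃ ≠ 0`.
research route, not a corollary; conditional on HC_CM plus one named minimal statement. -/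
theorem two_torsion_add_double_eq_zero_fifteen {κ t : A} (hκ : (2 : ℕ) • κ = 0) (ht : (15 : ℕ) • t = 0)
    (h : κ + (2 : ℕ) • t = 0) : κ = 0 ∧ t = 0 := by
  have hk : κ = -((2 : ℕ) • t) := eq_neg_of_add_eq_zero_left h
  have h4 : (4 : ℕ) • t = 0 := by
    have : (4 : ℕ) • t = (2 : ℕ) • ((2 : ℕ) • t) := by rw [← mul_nsmul]
    rw [this, ← neg_neg ((2 : ℕ) • t), ← hk, smul_neg, hκ, neg_zero]
  have ht0 : t = 0 := by
    have : t = (4 : ℕ) • ((4 : ℕ) • t) - (15 : ℕ) • t := by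
      rw [← mul_nsmul]; abel
    rw [this, h4, nsmul_zero, ht, sub_zero]
  refine ⟨?_, ht0⟩
  rw [hk, ht0, nsmul_zero, neg_zero]

/-- ELLBASE-G47 THEOREM G_E, the torsion step at `f = 30`: if `2 • κ = 0`, `30 • t = 0` and `κ + 2 • t = 0` then `κ = 0`
(here `t` need not vanish, but `2 • t = 0`).
research route, not a corollary; conditional on HC_CM plus one named minimal statement. -/
theorem two_torsion_add_double_eq_zero_thirty {κ t : A} (hκ : (2 : ℕ) • κ = 0) (ht : (30 : ℕ) • t = 0)
    (h : κ + (2 : ℕ) • t = 0) : κ = 0 ∧ (2 : ℕ) • t = 0 := by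
  have hk : κ = -((2 : ℕ) • t) := eq_neg_of_add_eq_zero_left h
  have h4 : (4 : ℕ) • t = 0 := by
    have : (4 : ℕ) • t = (2 : ℕ) • ((2 : ℕ) • t) := by rw [← mul_nsmul]
    rw [this, ← neg_neg ((2 : ℕ) • t), ← hk, smul_neg, hκ, neg_zero]
  have h2 : (2 : ℕ) • t = 0 := by
    have : (2 : ℕ) • t = (8 : ℕ) • ((4 : ℕ) • t) - (30 : ℕ) • t := by
      rw [← mul_nsmul]; abel
    rw [this, h4, nsmul_zero, ht, sub_zero]
  refine ⟨?_, h2⟩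
  rw [hk, h2, neg_zero]

/-- ELLBASE-G47 THEOREM G_E, the Riemann–Roch bookkeeping of Green's `H⁰`-lemma at the Castelnuovo boundary `s = 2`: for
`L = K' + D₀`, `M = K' + B' − D₀` on a curve of genus `g' ≥ 2` (`deg D₀ = 2`, `deg B' = 4`): `deg L = deg M = 2g'`,
`w = h⁰(L) = g' + 1`, `h¹(M ⊗ L⁻¹) = h⁰(K' + 2D₀ − B') = (2g' − 2) − g' + 1 + h⁰(B' − 2D₀) = g' − 1 + h⁰(B' − 2D₀)`, so the
hypothesis `h¹ ≤ w − 2` reads `h⁰(B' − 2D₀) = 0`, i.e. `2D₀ ≁ B'`; and `L`, `M` are base-point free since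
`deg(p − D₀) = deg(p − (B' − D₀)) = −1 < 0`.  Instance `g' = 3`: `6, 4, 2`.
research route, not a corollary; conditional on HC_CM plus one named minimal statement. -/
theorem green_boundary_bookkeeping (g : ℕ) (hg : 2 ≤ g) :
    (2 * g - 2 + 2 = 2 * g) ∧ (2 * g - 2 + 4 - 2 = 2 * g) ∧ (2 * g - g + 1 = g + 1) ∧
    ((2 * g - 2 : ℤ) - g + 1 = g - 1) ∧ ((g : ℤ) - 1 ≤ (g + 1) - 2) ∧ ((1 : ℤ) - 2 < 0) ∧
    (2 * 3 - 2 + 2 = 6 ∧ 3 + 1 = 4 ∧ 3 - 1 = 2) := by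
  omega

end everyMember

section twoNPoints

/-!
### P.S. 2 (same gen): THEOREM E⁺ — the two-`N`-point data at `f = 12` over an elliptic base are immersive at EVERY member

CLIFFORD-G44 THEOREM E (ii) left the hyperelliptic members of the two-`N`-point families (`m = 0`, `s = 2`, `g' ≥ 3`) open.
With Green's condition `2D₀ ∼ B' = π^*(N₁ + N₂)` (THEOREM G_E) and THEOREM E (o)'s `D₀ + ιD₀ ∼ π^*(N₁ + N₂)` a deficient class
satisfies `D₀ ∼ ιD₀`; then the class conditions `(h − 1)D₀ ∼ T'`, `12D₀ ∼ δ` of the four residue types contradict `N₁ ≠ N₂` by a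
linear elimination in `Pic C'` and the injectivity of `π^*`.  The four eliminations, in an arbitrary additive commutative group `P`:
-/

variable {P : Type*} [AddCommGroup P]

/-- ELLBASE-G47 THEOREM E⁺, type `N[1,9]` (`h = 5`; `T' = 2ιP₁ + 3π^*N₂`, `δ = P₁ + 5ιP₁ + 9π^*N₂`): in an additive commutative group,
from `2d = a + b`, `4d = 2u + 3b`, `12d = p + 5u + 9b`, `p + u = a` follows `a = b` (read: `a = π^*N₁`, `b = π^*N₂`, `d = D₀`, `u = [ιP₁]`,
`p = [P₁]`; with `π^*` injective this is `N₁ = N₂`, a contradiction).  [ELLBASE-G47 §8.2]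
research route, not a corollary; conditional on HC_CM plus one named minimal statement. -/
theorem chase_19 {a b d u p : P} (hG : (2:ℕ) • d = a + b) (hE : (4:ℕ) • d = (2:ℕ) • u + (3:ℕ) • b)
    (h1 : (12:ℕ) • d = p + (5:ℕ) • u + (9:ℕ) • b) (hp : p + u = a) : a = b := by
  have h4 : (4:ℕ) • d = (2:ℕ) • (a + b) := by rw [← hG, ← mul_nsmul]
  have h12 : (12:ℕ) • d = (6:ℕ) • (a + b) := by rw [← hG, ← mul_nsmul]
  have hu : (2:ℕ) • u = (2:ℕ) • (a + b) - (3:ℕ) • b := by rw [← h4, hE]; abel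
  have hp' : p = a - u := by rw [← hp]; abel
  have key : (6:ℕ) • (a + b) = (a - u) + (5:ℕ) • u + (9:ℕ) • b := by rw [← h12, h1, hp']
  have key2 : (6:ℕ) • (a + b) = a + (2:ℕ) • ((2:ℕ) • u) + (9:ℕ) • b := by rw [key]; abel
  rw [hu] at key2
  have : b - a = 0 := by
    calc b - a = (a + (2:ℕ) • ((2:ℕ) • (a + b) - (3:ℕ) • b) + (9:ℕ) • b) - (6:ℕ) • (a + b) := by abel
      _ = 0 := by rw [← key2, sub_self]
  exact (sub_eq_zero.mp this).symm

/-- ELLBASE-G47 THEOREM E⁺, type `N[3,7]` (`h = 5`; `T' = π^*N₁ + 2P₂ + 4ιP₂`, `δ = 3π^*N₁ + 7P₂ + 11ιP₂`; `q = [P₂]`, `v = [ιP₂]`, `q + v = b`): `a = b`.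
research route, not a corollary; conditional on HC_CM plus one named minimal statement. -/
theorem chase_37 {a b d v q : P} (hG : (2:ℕ) • d = a + b) (hE : (4:ℕ) • d = a + (2:ℕ) • q + (4:ℕ) • v)
    (h1 : (12:ℕ) • d = (3:ℕ) • a + (7:ℕ) • q + (11:ℕ) • v) (hq : q + v = b) : a = b := by
  have h4 : (4:ℕ) • d = (2:ℕ) • (a + b) := by rw [← hG, ← mul_nsmul]
  have h12 : (12:ℕ) • d = (6:ℕ) • (a + b) := by rw [← hG, ← mul_nsmul]
  have hq' : q = b - v := by rw [← hq]; abel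
  rw [hq'] at hE h1
  rw [h4] at hE
  rw [h12] at h1
  have : b - a = 0 := by
    calc b - a = (((3:ℕ) • a + (7:ℕ) • (b - v) + (11:ℕ) • v) - (6:ℕ) • (a + b))
                 - (2:ℕ) • ((a + (2:ℕ) • (b - v) + (4:ℕ) • v) - (2:ℕ) • (a + b)) := by abel
      _ = 0 := by rw [← h1, ← hE]; simp
  exact (sub_eq_zero.mp this).symm

/-- ELLBASE-G47 THEOREM E⁺, type `N[1,8]` (`h = 7`; `T' = 4ιP₁ + 4π^*N₂`, `δ = P₁ + 7ιP₁ + 8π^*N₂`; `p + u = a`): `a = b`.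
research route, not a corollary; conditional on HC_CM plus one named minimal statement. -/
theorem chase_18 {a b d u p : P} (hG : (2:ℕ) • d = a + b) (hE : (6:ℕ) • d = (4:ℕ) • u + (4:ℕ) • b)
    (h1 : (12:ℕ) • d = p + (7:ℕ) • u + (8:ℕ) • b) (hp : p + u = a) : a = b := by
  have h6 : (6:ℕ) • d = (3:ℕ) • (a + b) := by rw [← hG, ← mul_nsmul]
  have h12 : (12:ℕ) • d = (6:ℕ) • (a + b) := by rw [← hG, ← mul_nsmul]
  have hp' : p = a - u := by rw [← hp]; abel
  rw [hp'] at h1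
  rw [h6] at hE
  rw [h12] at h1
  have : b - a = 0 := by
    calc b - a = (2:ℕ) • (((a - u) + (7:ℕ) • u + (8:ℕ) • b) - (6:ℕ) • (a + b))
                 - (3:ℕ) • (((4:ℕ) • u + (4:ℕ) • b) - (3:ℕ) • (a + b)) := by abel
      _ = 0 := by rw [← h1, ← hE]; simp
  exact (sub_eq_zero.mp this).symm

/-- ELLBASE-G47 THEOREM E⁺, type `N[4,5]` (`h = 7`; `T' = 2π^*N₁ + 2P₂ + 6ιP₂`, `δ = 4π^*N₁ + 5P₂ + 11ιP₂`; `q + v = b`): `a = b`.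
research route, not a corollary; conditional on HC_CM plus one named minimal statement. -/
theorem chase_45 {a b d v q : P} (hG : (2:ℕ) • d = a + b) (hE : (6:ℕ) • d = (2:ℕ) • a + (2:ℕ) • q + (6:ℕ) • v)
    (h1 : (12:ℕ) • d = (4:ℕ) • a + (5:ℕ) • q + (11:ℕ) • v) (hq : q + v = b) : a = b := by
  have h6 : (6:ℕ) • d = (3:ℕ) • (a + b) := by rw [← hG, ← mul_nsmul]
  have h12 : (12:ℕ) • d = (6:ℕ) • (a + b) := by rw [← hG, ← mul_nsmul]
  have hq' : q = b - v := by rw [← hq]; abel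
  rw [hq'] at hE h1
  rw [h6] at hE
  rw [h12] at h1
  have : b - a = 0 := by
    calc b - a = (2:ℕ) • (((4:ℕ) • a + (5:ℕ) • (b - v) + (11:ℕ) • v) - (6:ℕ) • (a + b))
                 - (3:ℕ) • (((2:ℕ) • a + (2:ℕ) • (b - v) + (6:ℕ) • v) - (3:ℕ) • (a + b)) := by abel
      _ = 0 := by rw [← h1, ← hE]; simp
  exact (sub_eq_zero.mp this).symm

end twoNPoints

end Summit.HodgeConjecture.Ring2AbelianAll.PrymTorelliEllipticBase
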